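import Summits.SmoothPoincare4.SmoothPoincare4.Theses.SymplecticOrigami
import Summits.SmoothPoincare4.SmoothPoincare4.Theorems.NoGenusTwoDoor.Negative.NoncompactDoor
import Literature.Geometry.Symplectic.PlanarContactBoundary
import Literature.Geometry.Symplectic.SteinLiouville
import Literature.Topology.FourManifolds.Gluing
import Literature.AlgebraicTopology.SingularHomology.PoincareDuality

/-!
# Skeleton line `weinstein-door-presentation` for crux `NoGenusTwoDoor` (stmt-SmoothPoincare4-7842)

Route `SymplecticOrigami`, crux r2 `NoGenusTwoDoor` (D: no closed connected symplectic 4-manifold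
`(N, s)` has `(rank H₁, rank H₂) = (2, 1)` — a DOOR).  Idea card `Ideas/weinstein-door-presentation.md`
(crux-ideate r1 k1; triage r1-1/2/3: pass ×3, "partial by design; K2 (Liouville ⇒ Weinstein) has no
tool; treat as the Stein branch + refutation engine"), made CONCLUDING by the sharpening of
TRIAGE-r1-1: *"K2 is NOT needed one degree up: for `a ≫ 0` the Donaldson-curve complement
`N ∖ ν(C_a)` is WEINSTEIN (Giroux 2017) with `Q ≡ 0` and boundary `(Y_{g_a,−a²}, ξ_BW)`,
`g_a = (a² + a + 2)/2`, and NoGenusTwoDoor ⟺ ∀ a 'no `Q ⊗ ℚ ≡ 0` exact filling of `Y_{g_a,−a²}`'"*.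

THE LINE (Stein exclusion at high degree).  A door `(N, s)` has `b₂ = 1`, so `[s]` is a real
multiple of an integral class and Donaldson's theorem applies after rescaling: for `a ≫ 0` there is
a connected symplectic curve `C_a` Poincaré dual to `a·h`.  By Giroux (arXiv:1803.05929 = PAMQ 13
(2017), Thm 3 "Weinstein complements" + Cor 19 "Weinstein and Stein domains" after
Cieliebak–Eliashberg Thm 13.5, with Prop 6: the Liouville form restricts on the boundary to a
CONNECTION FORM of the normal circle bundle) the complement of an open tubular neighbourhood of the
Donaldson curve is a compact STEIN DOMAIN `W` whose boundary complex tangencies form the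
BOOTHBY–WANG (prequantization) contact structure of the Euler-number-`(−a²)` circle bundle over
`C_a`; and `N = W ∪_φ D` with `D` the closed normal disc bundle (STUB 1).  Mayer–Vietoris for this
gluing turns `(b₁, b₂)(N) = (2, 1)` into `b₁(W; ℚ) = 2` and `Q_W ⊗ ℚ ≡ 0`
(⟺ `H₂(∂W; ℚ) ↠ H₂(W; ℚ)`) (STUB 2).  Conversely (Giroux Rem 7: collapsing the Reeb circles of a
Boothby–Wang boundary of a Liouville domain yields a closed integral symplectic manifold) any Stein
domain with Boothby–Wang boundary, `b₁ = 2` and `Q_W ⊗ ℚ ≡ 0` caps to a closed symplectic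
`(b₁, b₂) = (2, 1)` manifold containing the base surface `Σ_g` with square `n`; unimodularity,
`b⁺ = 1`, `K² = 2χ + 3σ = 9 − 4b₁ = 1` and adjunction pin `n = a²`, `2g − 2 = a² + a` (the branch
`K = −h` is rational/ruled by Liu 1996, absurd) (STUB 3, theorem-level).  What is left is the card's
K1 at every degree — STUB 4 `stub_steinExclusion` (HARDEST, open, ⟺ crux modulo stubs 1–3 and the
capping converse `CappingConverse` below): **no compact Stein domain with `b₁ = 2` and identically
vanishing rational intersection form fills the Boothby–Wang structure on the Euler-number-`(−a²)`
circle bundle over the genus-`(a² + a + 2)/2` surface** (`a = 1`: `(Y_{2,−1}, ξ_BW)`, the card's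
two `tb = 1`, `rot = 0` Legendrian knots in `#2(S¹ × S²)`; `a = 2`: `(Y_{4,−4}, ξ_BW)`, `χ(W) = 5`,
the pencil cards' PALF census).  By Gompf–Eliashberg (tree facts `Gompf1998_thm13_noTwoHandles`,
`Gompf1998_thm13_twoHandles`) STUB 4 is a statement about Legendrian links in `#k(S¹ × S²)`:
`k` 1-handles, `k + a² + a − 2` 2-handles with framing `tb − 1`, framing/linking form identically
zero on the null-homologous sublattice (`tb = 1`, `lk = 0` there), total surgery the circle bundle
with its Zoll contact form — the crux dragged from symplectic geography to front diagrams.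

`NoGenusTwoDoor_of` composes the four stubs into the crux BY NAME (kernel-checked, no `sorry`
outside `stub_*`).

Vocabulary (plain definitions over the tree; no object is posited): `IsBoothbyWang ξ g n` on an
abstract closed 3-manifold `M` (Boothby–Wang 1958 / Geiges 2008 §7.2 "regular contact forms": `ξ`
is the kernel of a contact form `α` whose Reeb flow is a FREE CIRCLE ACTION `Φ : ℝ → M → M` of
period `1` — `α(R) = 1`, `ι_R dα = 0` for the generator `R` — with orbit space a closed surface of
genus `g` (`rank H₁ = 2g`) and `|Tors H₁(M; ℤ)| = n` (for the circle bundle `Y_{g,e}`, `e ≠ 0`: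
`H₁ = ℤ^{2g} ⊕ ℤ/|e|`, so `n = |e|`)); `IsBoothbyWangBoundary S b g n` = that predicate for the
complex tangencies of the Stein structure `S` pulled back to the boundary datum `b`
(`Literature.Geometry.Symplectic.boundaryPlaneField`, as in `PlanarContactBoundary`);
`BoundarySpansH2 b` = `H₂(∂W; ℚ) → H₂(W; ℚ)` onto (⟺ `Q_W ⊗ ℚ ≡ 0` by Lefschetz duality);
`IsRationalSurfaceCap D bD` = the three rational-homology properties of a disc bundle of non-zero
Euler number over a closed connected orientable surface that Mayer–Vietoris consumes.

Disproof used (`Cruxes/NoGenusTwoDoor/Disproof.lean` v3, cdisprove gen 1–2, read 2026-08-16):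
* §5 `…false_without_compact` (LANDED `Negative.NoncompactDoor`, p73639/p74187, IMPORTED here):
  every stub keeps `[CompactSpace]` on `N`, `W`, `D`; the witness `(ℝ² ∖ 0)² ⊂ ℝ⁴` is an instance of
  no stub (bookkeeping `example` at the end of the file).
* §10 `ruledT2_genus_two_classes` / `ruledT2_filling_numerics`: EXACT fillings of `(Y_{2,−1}, ξ_BW)`
  with `b₁ = 2` EXIST (`(χ, b⁻) = (k + 2, k + 1)`, `k ≥ 1`) — so STUB 4 is FALSE without its
  hypothesis `BoundarySpansH2` (`Q_W ⊗ ℚ ≡ 0`): the line uses `b₂(N) = 1` exactly there (STUB 2),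
  and `b⁻(W) = 0` is the margin separating the door from that family (the door is its `k = −1`
  extrapolation).
* §9 `complement_bookkeeping` (`W = N ∖ νB` is Weinstein only if `r = 2`): sidestepped — the line
  never uses the degree-1 Taubes curve; at degree `a ≫ 0` the complement is Stein by Giroux's
  theorem, unconditionally (triage r1-1 sharpening; the card's K2 is gone).
* §8 `pencil_numerics`: the same family `2g − 2 = a² + a` (STUB 3's conclusion); §4
  `filling_numerics` is STUB 3 at `a = 1`.
* `ledger negatives --problem SmoothPoincare4` = 0; dead_lines = [].
-/

noncomputable section

-- the prescribed namespace `Summit.<P>.<Sub>.…` duplicates `SmoothPoincare4` (P = Sub)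
set_option linter.dupNamespace false

open scoped Manifold ContDiff Topology
open Set Function
open Literature.Geometry.Kaehler (MForm IsSmoothForm IsClosedForm mextDeriv)
open Literature.Geometry.Symplectic (SteinStructure boundaryPlaneField wedge₁₂)
open Literature.Topology.FourManifolds (BoundaryData IsBoundaryGluing singularHomologyZ)
open Literature.AlgebraicTopology.SingularHomology (singularHomology bettiNumber)
open Summit.SmoothPoincare4.SmoothPoincare4.Theses.SymplecticOrigami (NoGenusTwoDoor)

namespace Summit.SmoothPoincare4.SmoothPoincare4.Cruxes.NoGenusTwoDoor.WeinsteinDoorPresentation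

/-! ### Vocabulary (plain definitions over the tree; no new objects are posited) -/

section Vocabulary

variable {M : Type} [TopologicalSpace M] [ChartedSpace (EuclideanSpace ℝ (Fin 3)) M]

/-- The infinitesimal generator `R(y) = ∂ₜ|₀ Φ(t, y) ∈ T_yM = ℝ³` of a flow `Φ : ℝ → M → M` on a
3-manifold (manifold derivative of the orbit map at `t = 0`, applied to `1 ∈ T₀ℝ`). -/
def flowVector (Φ : ℝ → M → M) (y : M) : EuclideanSpace ℝ (Fin 3) :=
  mfderiv 𝓘(ℝ, ℝ) (𝓡 3) (fun t : ℝ => Φ t y) (0 : ℝ) (1 : ℝ)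

/-- **Boothby–Wang (prequantization / regular) contact structure** on the closed 3-manifold `M`
with plane field `ξ`, base genus `g` and Euler number `±n` (Boothby–Wang, Ann. Math. 68 (1958);
Geiges 2008, §7.2; Giroux arXiv:1803.05929 Prop 6 / Rem 7 — "`∂F` has the structure of a principal
circle bundle … `λ` induces a connection form"): there are a smooth CONTACT form `α` with
`ker α = ξ` and a smooth flow `Φ` of period `1` acting FREELY (`Φₜ y = y ⇒ t ∈ ℤ`) whose generator
`R` is the REEB field of `α` (`α(R) = 1`, `ι_R dα = 0`; hence `α` is `Φ`-invariant and `dα`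
descends to an area form on the orbit space), a continuous surjection `π` onto a closed connected
surface `B` whose fibres are exactly the orbits (so `B ≅ M/S¹`, the base; genus recorded as
`rank H₁(B; ℤ) = 2g`), and `|Tors H₁(M; ℤ)| = n` (for the circle bundle of Euler number `e ≠ 0` over
`Σ_g`: `H₁ = ℤ^{2g} ⊕ ℤ/|e|`, `n = |e|`; `e ≠ 0` is automatic, `dα` being non-degenerate on `B`).
No orientation or coorientation is recorded (`-α`, `Φ₋ₜ` serve as well).  Model: `M = S³ ⊂ ℂ²`,
`ξ_std`, `α = Σⱼ (xⱼ dyⱼ − yⱼ dxⱼ)/(2π)`, `Φₜ(z) = e^{2πit} z` (`R = 2πiz`, `α(R) = 1`), `B = ℂP¹`,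
`(g, n) = (0, 1)`. -/
def IsBoothbyWang (ξ : M → Submodule ℝ (EuclideanSpace ℝ (Fin 3))) (g n : ℕ) : Prop :=
  ∃ (α : MForm (𝓡 3) M ℝ 1) (Φ : ℝ → M → M) (B : Type) (_ : TopologicalSpace B) (_ : T2Space B)
    (_ : CompactSpace B) (_ : ConnectedSpace B) (_ : ChartedSpace (EuclideanSpace ℝ (Fin 2)) B)
    (_ : IsManifold (𝓡 2) ∞ B) (π : M → B),
    IsSmoothForm α ∧
    (∀ (y : M) (v : EuclideanSpace ℝ (Fin 3)), α y ![v] = 0 ↔ v ∈ ξ y) ∧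
    (∀ y : M, ∃ u v w : EuclideanSpace ℝ (Fin 3), wedge₁₂ (α y) (mextDeriv α y) u v w ≠ 0) ∧
    ContMDiff (𝓘(ℝ, ℝ).prod (𝓡 3)) (𝓡 3) ∞ (Function.uncurry Φ) ∧
    Φ 0 = id ∧ (∀ s t : ℝ, Φ (s + t) = Φ s ∘ Φ t) ∧ Φ 1 = id ∧
    (∀ (t : ℝ) (y : M), Φ t y = y → ∃ k : ℤ, t = (k : ℝ)) ∧
    (∀ y : M, α y ![flowVector Φ y] = 1) ∧
    (∀ (y : M) (v : EuclideanSpace ℝ (Fin 3)), mextDeriv α y ![flowVector Φ y, v] = 0) ∧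
    Continuous π ∧ Function.Surjective π ∧ (∀ y y' : M, π y = π y' ↔ ∃ t : ℝ, Φ t y = y') ∧
    Module.finrank ℤ (singularHomologyZ B 1) = 2 * g ∧
    Nat.card (Submodule.torsion ℤ (singularHomologyZ M 1)) = n

end Vocabulary

section SteinVocabulary

variable {W : Type} [TopologicalSpace W] [ChartedSpace (EuclideanHalfSpace 4) W]

/-- **The Stein domain `(W, S)` has Boothby–Wang boundary of type `(g, n)`** on the boundary datum
`b` (a closed 3-manifold `b.carrier ≅ ∂W`): the complex tangencies `ξ = T∂W ∩ J T∂W` of `S.J`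
pulled back to `b.carrier` (`boundaryPlaneField`, `PlanarContactBoundary.lean`) are Boothby–Wang.
For the Stein complement of a Donaldson curve this is Giroux's Prop 6 + Cor 19 (the Stein contact
form `-d^ℂφ` and the connection form have the same kernel along `∂W`). -/
def IsBoothbyWangBoundary [IsManifold (𝓡∂ 4) ∞ W] [CompactSpace W] (S : SteinStructure W)
    (b : BoundaryData (𝓡∂ 4) W (𝓡 3)) (g n : ℕ) : Prop :=
  IsBoothbyWang (boundaryPlaneField S.J b) g n

/-- **`Q_W ⊗ ℚ ≡ 0` in boundary form**: `H₂(∂W; ℚ) → H₂(W; ℚ)` is onto (every rational 2-class is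
carried by the boundary; by Lefschetz duality this is exactly the identical vanishing of the
rational intersection form of the compact 4-manifold `W`). -/
def BoundarySpansH2 (b : BoundaryData (𝓡∂ 4) W (𝓡 3)) : Prop :=
  Function.Surjective
    (singularHomology.map ℚ ℚ (⟨b.incl, b.continuous_incl⟩ : C(b.carrier, W)) 2)

/-- **Rational-homology signature of a disc-bundle cap**: the compact 4-manifold `D` with boundary
datum `bD` has connected boundary, `H₁(∂D; ℚ) → H₁(D; ℚ)` bijective, `H₂(∂D; ℚ) → H₂(D; ℚ)` zero
and `b₂(D; ℚ) = 1` — the Gysin bookkeeping of the closed disc bundle of Euler number `e ≠ 0` over a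
closed connected orientable surface `Σ` (`∂D → Σ` a circle bundle: `H₁(∂D) → H₁(Σ)` onto with
kernel `ℤ/e`, `H₂(∂D) → H₂(Σ) = ℤ` has image `ker(·e) = 0`, `D ≃ Σ`).  Exactly what STUB 2's
Mayer–Vietoris consumes; nothing bundle-theoretic is typed. -/
def IsRationalSurfaceCap (D : Type) [TopologicalSpace D] [ChartedSpace (EuclideanHalfSpace 4) D]
    (bD : BoundaryData (𝓡∂ 4) D (𝓡 3)) : Prop :=
  ConnectedSpace bD.carrier ∧
    Function.Bijective
      (singularHomology.map ℚ ℚ (⟨bD.incl, bD.continuous_incl⟩ : C(bD.carrier, D)) 1) ∧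
    (∀ x, singularHomology.map ℚ ℚ (⟨bD.incl, bD.continuous_incl⟩ : C(bD.carrier, D)) 2 x = 0) ∧
    bettiNumber ℚ D 2 = 1

end SteinVocabulary

/-! ### The four stub STATEMENTS (named `Prop`s; the registered `stub_*` theorems below restate
them verbatim, and `Registered.stub_*` are their name-keyed aliases used as the hypotheses of
`NoGenusTwoDoor_of` — the native skeleton audit admits hypotheses BY NAME; same device as
`Cruxes/OrigamiFoldExistence/Lines/round-trace-continuity.lean`) -/

/-- Statement of STUB 1 [Donaldson–Giroux decomposition at `b₂ = 1`]. -/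
def DonaldsonGirouxDecomposition : Prop :=
  ∀ (N : Type) [TopologicalSpace N] [T2Space N] [SecondCountableTopology N] [CompactSpace N]
    [ConnectedSpace N] [ChartedSpace (EuclideanSpace ℝ (Fin 4)) N] [IsManifold (𝓡 4) ∞ N]
    (s : MForm (𝓡 4) N ℝ 2),
    IsSmoothForm s → IsClosedForm s →
    (∀ x (v : TangentSpace (𝓡 4) x), v ≠ 0 → ∃ w, s x ![v, w] ≠ 0) →
    Module.finrank ℤ (singularHomologyZ N 2) = 1 →
    ∃ (W : Type) (_ : TopologicalSpace W) (_ : T2Space W) (_ : SecondCountableTopology W)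
      (_ : CompactSpace W) (_ : ConnectedSpace W) (_ : ChartedSpace (EuclideanHalfSpace 4) W)
      (_ : IsManifold (𝓡∂ 4) ∞ W) (S : SteinStructure W)
      (D : Type) (_ : TopologicalSpace D) (_ : T2Space D) (_ : SecondCountableTopology D)
      (_ : CompactSpace D) (_ : ChartedSpace (EuclideanHalfSpace 4) D) (_ : IsManifold (𝓡∂ 4) ∞ D)
      (bW : BoundaryData (𝓡∂ 4) W (𝓡 3)) (bD : BoundaryData (𝓡∂ 4) D (𝓡 3))
      (φ : bW.carrier ≃ bD.carrier) (g n : ℕ),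
      IsBoundaryGluing bW bD φ (𝓡 4) N ∧ IsRationalSurfaceCap D bD ∧ IsBoothbyWangBoundary S bW g n

/-- Statement of STUB 2 [complement Betti numbers: Mayer–Vietoris for the gluing]. -/
def ComplementBetti : Prop :=
  ∀ (P : Type) [TopologicalSpace P] [T2Space P] [SecondCountableTopology P] [CompactSpace P]
    [ChartedSpace (EuclideanSpace ℝ (Fin 4)) P] [IsManifold (𝓡 4) ∞ P]
    (W : Type) [TopologicalSpace W] [T2Space W] [SecondCountableTopology W] [CompactSpace W]
    [ChartedSpace (EuclideanHalfSpace 4) W] [IsManifold (𝓡∂ 4) ∞ W]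
    (D : Type) [TopologicalSpace D] [T2Space D] [SecondCountableTopology D] [CompactSpace D]
    [ChartedSpace (EuclideanHalfSpace 4) D] [IsManifold (𝓡∂ 4) ∞ D]
    (bW : BoundaryData (𝓡∂ 4) W (𝓡 3)) (bD : BoundaryData (𝓡∂ 4) D (𝓡 3))
    (φ : bW.carrier ≃ bD.carrier),
    IsBoundaryGluing bW bD φ (𝓡 4) P → IsRationalSurfaceCap D bD →
    Module.finrank ℤ (singularHomologyZ P 1) = 2 → Module.finrank ℤ (singularHomologyZ P 2) = 1 →
    bettiNumber ℚ W 1 = 2 ∧ BoundarySpansH2 bW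

/-- Statement of STUB 3 [capping + adjunction: the door numerics of a Boothby–Wang Stein filling]. -/
def CappingAdjunction : Prop :=
  ∀ (W : Type) [TopologicalSpace W] [T2Space W] [SecondCountableTopology W] [CompactSpace W]
    [ConnectedSpace W] [ChartedSpace (EuclideanHalfSpace 4) W] [IsManifold (𝓡∂ 4) ∞ W]
    (S : SteinStructure W) (bW : BoundaryData (𝓡∂ 4) W (𝓡 3)) (g n : ℕ),
    IsBoothbyWangBoundary S bW g n → bettiNumber ℚ W 1 = 2 → BoundarySpansH2 bW →
    ∃ a : ℕ, 1 ≤ a ∧ n = a ^ 2 ∧ 2 * g = a ^ 2 + a + 2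

/-- Statement of STUB 4 [Stein exclusion at the door numerics — HARDEST]. -/
def SteinExclusion : Prop :=
  ∀ (W : Type) [TopologicalSpace W] [T2Space W] [SecondCountableTopology W] [CompactSpace W]
    [ConnectedSpace W] [ChartedSpace (EuclideanHalfSpace 4) W] [IsManifold (𝓡∂ 4) ∞ W]
    (S : SteinStructure W) (bW : BoundaryData (𝓡∂ 4) W (𝓡 3)) (g a : ℕ),
    1 ≤ a → 2 * g = a ^ 2 + a + 2 → IsBoothbyWangBoundary S bW g (a ^ 2) →
    bettiNumber ℚ W 1 = 2 → BoundarySpansH2 bW → False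

/-! ### The registered stubs -/

/-- STUB 1 [Donaldson–Giroux decomposition] (XL; a THEOREM in print).  Let `(N, s)` be a closed
connected symplectic 4-manifold with `rank H₂(N; ℤ) = 1`.  Then `N` is a boundary gluing
`W ∪_φ D` (tree `IsBoundaryGluing`: smooth codimension-0 embeddings of the compact pieces covering
`N` and meeting exactly along `∂W ≡_φ ∂D`) of a compact connected STEIN domain `W` whose complex
tangencies on `∂W` are Boothby–Wang of some type `(g, n)`, and a compact `D` with the rational
homology signature of a disc bundle of non-zero Euler number over a closed surface.
Proof in print: `H²(N; ℝ) ≅ ℝ`, so after multiplying `s` by a constant `[s]` is the image of a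
generator `h` of `H²(N; ℤ)/torsion` (de Rham + universal coefficients); Donaldson (JDG 44 (1996)
Thm 1: for `a ≫ 0` a symplectic submanifold `C_a` Poincaré dual to `a[s]` whose inclusion is
1-connected, so `C_a` is connected) and Giroux (arXiv:1803.05929 Thm 3: a Weinstein domain `(F, λ)`
and `q : F → N` with `q(∂F) = C_a`, `∂F` the normal circle bundle projecting by `q`, `q` a
diffeomorphism `F ∖ ∂F → N ∖ C_a`, `q*s = dλ`; Prop 6: `-2aπiλ` is a unitary connection on `∂F`,
i.e. `λ|∂F` is a positive multiple of a connection 1-form `α` with `dα = q*s|_{C_a}` — its Reeb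
flow is the principal circle action: Boothby–Wang with base `C_a` of genus `g` and
`n = |e(∂F → C_a)| = C_a·C_a = a²[s]² > 0`; Cor 19 = Cieliebak–Eliashberg Thm 13.5 + Gray + Moser:
a complex structure `J` on `F` and a `J`-convex Morse `φ : F → ℝ_{≤0}` with regular level
`∂F = {φ = 0}`, `dλ = dd^Jφ` and — from the proof — `d^Jφ = w·λ` along `∂F`, so the complex
tangencies of `(F, J)` ARE `ker λ|∂F`), `W := {φ ≤ −ε} ⊂ F`, the sublevel set below a small regular value (diffeomorphic to `F` along the
Liouville collar, embedded in `N` as the complement of an open tubular neighbourhood of `C_a`, and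
a Stein domain in the tree's sense: integrable `J`, `J`-convex `φ` with `∂W` its regular MAXIMAL
level set; its complex tangencies are contactomorphic to `ker λ|∂F` by Gray stability along the
collar, and `IsBoothbyWang` is invariant under diffeomorphisms carrying the plane field); `D :=` a closed tubular neighbourhood of `C_a` shrunk inside `q`'s collar, `φ` the
induced identification of the two copies of the normal circle bundle; the cap clauses are the Gysin
sequence of `∂D → C_a` with `e = a²[s]² ≠ 0` (`H₁(∂D; ℚ) ≅ H₁(C_a; ℚ)`, `H₂(∂D; ℚ) → H₂(C_a; ℚ)`
zero, `b₂(D) = b₂(C_a) = 1`, `∂D` connected).  Non-vacuous and door-independent: for `ℂP²` it is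
the affine complement of a smooth degree-`a` curve glued to its normal disc bundle
(`(g, n) = ((a−1)(a−2)/2, a²)`); for a door `(g, n) = ((a² + a + 2)/2, a²)` (STUB 3 re-derives
this from the far side).  Why it might fail: only through the TYPING — the flow/orbit-space clauses
of `IsBoothbyWang` must be met by the genuine principal circle action (they are, by Prop 6), and
the tree's `SteinStructure` wants `∂W` to be the MAXIMAL level set of `φ` (Cor 19 gives
`φ ≤ 0 = φ|∂F`).  Sources: Donaldson1996 Thm 1 (+ Prop 39), Giroux2018 (arXiv:1803.05929) Thm 3,
Prop 6, Cor 19, Lemma 20; CieliebakEliashberg2012 Thm 13.5; BoothbyWang1958; Auroux (JSG 1 (2001))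
for uniqueness up to isotopy (not needed).  Size: XL (Donaldson–Auroux–Giroux asymptotically
holomorphic theory + CE; none of it is in the tree) — to be carried as cite facts by the lead. -/
theorem stub_donaldsonGirouxDecomposition :
    ∀ (N : Type) [TopologicalSpace N] [T2Space N] [SecondCountableTopology N] [CompactSpace N]
      [ConnectedSpace N] [ChartedSpace (EuclideanSpace ℝ (Fin 4)) N] [IsManifold (𝓡 4) ∞ N]
      (s : MForm (𝓡 4) N ℝ 2),
      IsSmoothForm s → IsClosedForm s →
      (∀ x (v : TangentSpace (𝓡 4) x), v ≠ 0 → ∃ w, s x ![v, w] ≠ 0) →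
      Module.finrank ℤ (singularHomologyZ N 2) = 1 →
      ∃ (W : Type) (_ : TopologicalSpace W) (_ : T2Space W) (_ : SecondCountableTopology W)
        (_ : CompactSpace W) (_ : ConnectedSpace W) (_ : ChartedSpace (EuclideanHalfSpace 4) W)
        (_ : IsManifold (𝓡∂ 4) ∞ W) (S : SteinStructure W)
        (D : Type) (_ : TopologicalSpace D) (_ : T2Space D) (_ : SecondCountableTopology D)
        (_ : CompactSpace D) (_ : ChartedSpace (EuclideanHalfSpace 4) D)
        (_ : IsManifold (𝓡∂ 4) ∞ D)
        (bW : BoundaryData (𝓡∂ 4) W (𝓡 3)) (bD : BoundaryData (𝓡∂ 4) D (𝓡 3))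
        (φ : bW.carrier ≃ bD.carrier) (g n : ℕ),
        IsBoundaryGluing bW bD φ (𝓡 4) N ∧ IsRationalSurfaceCap D bD ∧
          IsBoothbyWangBoundary S bW g n := by
  sorry

/-- STUB 2 [complement Betti numbers] (M–L; PROVABLE NOW in principle — pure algebraic topology).
For a closed 4-manifold `P = W ∪_φ D` glued from compact pieces along their (identified) connected
boundary `Y`, with `D` a rational-surface cap (`H₁(Y; ℚ) ≅ H₁(D; ℚ)`, `H₂(Y; ℚ) → H₂(D; ℚ)` zero,
`b₂(D) = 1`) and `(rank H₁(P; ℤ), rank H₂(P; ℤ)) = (2, 1)`: `b₁(W; ℚ) = 2` and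
`H₂(∂W; ℚ) ↠ H₂(W; ℚ)`.  Proof: Mayer–Vietoris over `ℚ` for the excisive decomposition (collar the
seam): `H₂(Y) → H₂(W) ⊕ H₂(D) → H₂(P) → H₁(Y) → H₁(W) ⊕ H₁(D) → H₁(P) → H₀(Y) ↪ H₀(W) ⊕ H₀(D)`
(`Y` connected).  The `D`-component of `H₁(Y) → H₁(W) ⊕ H₁(D)` is injective, so
`b₁(P) = b₁(W) + b₁(D) − b₁(Y) = b₁(W)` and `H₂(P; ℚ) ≅ coker(H₂(Y) → H₂(W) ⊕ H₂(D)) =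
H₂(W)/im H₂(Y) ⊕ H₂(D)`, i.e. `b₂(P) = b₂(W) − rk(im) + 1`; hence `b₂(P) = 1 ⟺ H₂(Y) ↠ H₂(W)`.
Finally `rank_ℤ Hₖ(P; ℤ) = dim_ℚ Hₖ(P; ℚ)` (universal coefficients; `Hₖ` finitely generated for a
compact manifold) and Mathlib's `singularHomologyZ` is the tree's `singularHomology ℤ ℤ`
(`SingularChains.lean`: same functor).  Why it might fail: it cannot mathematically; formally the
Mayer–Vietoris sequence for a CLOSED gluing needs the collar/excision step (tree:
`BoundaryGluingData`, `BoundaryGluingRelHomology.lean`, `ExcisionMayerVietoris.lean`,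
`FieldBaseChange.lean`).  Sources: Hatcher2002 §2.2 (Mayer–Vietoris), §3.3; BrockerJanich1982 §13
(collars of glued pieces).  Size: M (maths) / L (Lean). -/
theorem stub_complementBetti :
    ∀ (P : Type) [TopologicalSpace P] [T2Space P] [SecondCountableTopology P] [CompactSpace P]
      [ChartedSpace (EuclideanSpace ℝ (Fin 4)) P] [IsManifold (𝓡 4) ∞ P]
      (W : Type) [TopologicalSpace W] [T2Space W] [SecondCountableTopology W] [CompactSpace W]
      [ChartedSpace (EuclideanHalfSpace 4) W] [IsManifold (𝓡∂ 4) ∞ W]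
      (D : Type) [TopologicalSpace D] [T2Space D] [SecondCountableTopology D] [CompactSpace D]
      [ChartedSpace (EuclideanHalfSpace 4) D] [IsManifold (𝓡∂ 4) ∞ D]
      (bW : BoundaryData (𝓡∂ 4) W (𝓡 3)) (bD : BoundaryData (𝓡∂ 4) D (𝓡 3))
      (φ : bW.carrier ≃ bD.carrier),
      IsBoundaryGluing bW bD φ (𝓡 4) P → IsRationalSurfaceCap D bD →
      Module.finrank ℤ (singularHomologyZ P 1) = 2 →
      Module.finrank ℤ (singularHomologyZ P 2) = 1 →
      bettiNumber ℚ W 1 = 2 ∧ BoundarySpansH2 bW := by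
  sorry

/-- STUB 3 [capping + adjunction] (XL; THEOREM-LEVEL, everything in print).  A compact connected
Stein domain `W` with Boothby–Wang boundary of type `(g, n)`, `b₁(W; ℚ) = 2` and `Q_W ⊗ ℚ ≡ 0` has
the DOOR NUMERICS: `n = a²` and `2g − 2 = a² + a` for some integer `a ≥ 1`.  Proof in print:
(i) CAP (Giroux arXiv:1803.05929 Rem 7 + Lemma 8; equivalently glue Biran's standard symplectic
disc bundle, ibid. Cor 5): the Stein Liouville form `-d^ℂφ` restricts on `∂W` to a contact form
for `ξ`, hence to `f·α` with `α` the regular (connection) form of `IsBoothbyWang`; after inserting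
the piece of symplectisation between the graphs of `fα` and `cα`, collapsing the Reeb circles of
`∂W` gives a CLOSED symplectic 4-manifold `X ⊃ W` in which the orbit surface `Σ_g = B` sits as a
symplectic surface with `Σ·Σ = |e| = n ≥ 1` (the torsion of `H₁(Y_{g,e})` is `ℤ/|e|`).
(ii) MAYER–VIETORIS (as in STUB 2, now with `b₁(W) = 2`, `Q_W ⊗ ℚ ≡ 0` as input):
`b₁(X) = b₁(W) = 2`, `b₂(X) = 1`.  (iii) LATTICE: `b⁺ = 1` (`[ω]² > 0`), `b⁻ = 0`, `σ = 1`,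
`χ(X) = −1`, `H₂(X)/tors = ℤh`, `h² = 1` (unimodular), `[Σ] = m h` with `m² = n` — so `n = a²`,
`a ≥ 1`, and `[Σ] = a h` once `h` is oriented by `[ω]·h > 0` (`Σ` symplectic); almost-complex
numerics `K = k h`, `K² = k² = 2χ + 3σ = 1`, `k = ±1`.  (iv) ADJUNCTION for the embedded
symplectic `Σ` (McDuff–Salamon 2017; Gompf–Stipsicz 1999): `2g − 2 = Σ² + K·Σ = a² + k a`.
(v) `k = −1` is absurd: then `K·[ω] < 0` while `X` is MINIMAL (`b⁻ = 0`: no exceptional sphere),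
so `X` is rational or ruled (Liu, MRL 3 (1996) = McDuffSalamon2017 Rem 13.3.28 (ii), READ p. 531;
Ohta–Ono 1996), contradicting `(b₁, b₂) = (2, 1)`; hence `k = 1`, `2g − 2 = a² + a`.  So the only
Boothby–Wang boundaries a `b₁ = 2`, `Q ≡ 0` Stein domain can have are those of the DOOR
COMPLEMENTS `(g_a, a²) = (2, 1), (4, 4), (7, 9), (11, 16), …` (= Disproof §8 `pencil_numerics`;
`a = 1` is Disproof §4 `filling_numerics`).  Why it might fail: only the typing of `IsBoothbyWang`
(`n` read as `|Tors H₁(∂W; ℤ)|`; genus as `rank H₁(B)`) — mathematically a theorem.  Sources: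
Giroux2018 Rem 7, Lemma 8, Cor 5; Liu1996 (= McDuffSalamon2017 Rem 13.3.28 (ii)); OhtaOno1996;
McDuffSalamon2017 (13.3.17) (adjunction); GompfStipsicz1999 §10.1.  Size: XL (symplectic capping, SW-based
Liu theorem and adjunction are not in the tree; the lattice arithmetic is Disproof §2
`door_numerics`). -/
theorem stub_cappingAdjunction :
    ∀ (W : Type) [TopologicalSpace W] [T2Space W] [SecondCountableTopology W] [CompactSpace W]
      [ConnectedSpace W] [ChartedSpace (EuclideanHalfSpace 4) W] [IsManifold (𝓡∂ 4) ∞ W]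
      (S : SteinStructure W) (bW : BoundaryData (𝓡∂ 4) W (𝓡 3)) (g n : ℕ),
      IsBoothbyWangBoundary S bW g n → bettiNumber ℚ W 1 = 2 → BoundarySpansH2 bW →
      ∃ a : ℕ, 1 ≤ a ∧ n = a ^ 2 ∧ 2 * g = a ^ 2 + a + 2 := by
  sorry

/-- STUB 4 [STEIN EXCLUSION] — HARDEST, the load-bearing open statement of the line (the card's K1
"Weinstein exclusion", at every degree `a ≥ 1`; ⟺ the crux modulo STUBS 1–3 and `CappingConverse`).
**No compact connected Stein domain `W` with `b₁(W; ℚ) = 2` and identically vanishing rational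
intersection form (`H₂(∂W; ℚ) ↠ H₂(W; ℚ)`) has Boothby–Wang boundary of type
`(g, n) = ((a² + a + 2)/2, a²)`**, i.e. is a Stein filling of the prequantization contact
structure `ξ_BW` on the Euler-number-`(−a²)` circle bundle over the genus-`g_a` surface
(`a = 1`: `(Y_{2,−1}, ξ_BW) = Σ(2,5,10)`-link; `a = 2`: `Y_{4,−4}`; …).  What such a `W` would look
like (Gompf 1998 Thm 1.3 = tree facts `Gompf1998_thm13_noTwoHandles` + `Gompf1998_thm13_twoHandles`
read backwards; Disproof §9 numerics): a Legendrian surgery diagram `B⁴ ∪ k` 1-handles `∪`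
`(k + a² + a − 2)` 2-handles along a Legendrian link in `(#k S¹ × S², ξ_std)` with framings
`tb − 1`, whose attaching classes span a corank-2 sublattice of `H₁(#k S¹ × S²) = ℤᵏ` (`b₁ = 2`),
with framing/linking form IDENTICALLY ZERO on the lattice of null-homologous combinations
(`Q_W ≡ 0`: `tb = 1`, pairwise `lk = 0` there), `χ(W) = a² + a − 1`, `b₂(W) = a² + a = 2g − 2`,
total space of the surgery the circle bundle `Y_{g_a,−a²}` with its ZOLL (regular) contact form;
`π₁(W)` is then a quotient of the circle-bundle group, `π₁` of the capped door a quotient of the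
surface group `Γ_{g_a}` with `b₁ = 2` obeying Disproof §2 `no_small_b1_cover`.  Why plausibly true:
it is equivalent to the crux (Gompf's `χ ≥ 0` question at its extremal corner; Stipsicz 2002 Rem 3.4,
T.-J. Li 2015 §4.3.1, Kotschick 2006 record the belief); every KNOWN Stein/exact filling of a
Boothby–Wang 3-manifold with `Q ⊗ ℚ ≡ 0` has `b₁ = 0` (affine complements `ℂP² ∖ C_a`, fake planes)
and every known `b₁ = 2` filling has `Q ≠ 0` (Disproof §10: `(T² × S²) # k\overline{ℂP²} ∖ νB`,
`b⁻ = k + 1 ≥ 2`).  Why it might fail: it is as open as the crux — a single Legendrian link as above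
IS a door (negative side: the card's kit search at `a = 1`, two `tb = 1`, `rot = 0`, `lk = 0`
null-homologous knots in `#2(S¹ × S²)`); no known Stein/Legendrian obstruction (Lisca–Matić
adjunction, `tb`/`rot` bounds, contact class, planarity) is violated by these numerics, so a proof
needs a NEW rigidity statement for Zoll-boundary Stein domains (candidate first rungs for the lead:
`a = 1` with `k = 2`; planar/low-genus open books of `ξ_BW` vs Wendl–Etnyre obstructions; the
PALF form of `W` — a positive factorisation of the Boothby–Wang open-book monodromy with
`b₁ = 2`, thimble form `≡ 0`, shared with cards albanese-isotropic-pencil /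
pencil-coisotropic-factorization).  Sources: Gompf1998 Thm 1.3, §2; Giroux2018; Disproof §§2, 9,
10; doi:10.1007/s002220050171 (Lisca–Matić 1997); doi:10.1016/s0166-8641(00)00105-x (Stipsicz 2002
Rem 3.4); arXiv:1511.04831 §4.3.1; arXiv:math/0504578.  Size: open-problem. -/
theorem stub_steinExclusion :
    ∀ (W : Type) [TopologicalSpace W] [T2Space W] [SecondCountableTopology W] [CompactSpace W]
      [ConnectedSpace W] [ChartedSpace (EuclideanHalfSpace 4) W] [IsManifold (𝓡∂ 4) ∞ W]
      (S : SteinStructure W) (bW : BoundaryData (𝓡∂ 4) W (𝓡 3)) (g a : ℕ),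
      1 ≤ a → 2 * g = a ^ 2 + a + 2 → IsBoothbyWangBoundary S bW g (a ^ 2) →
      bettiNumber ℚ W 1 = 2 → BoundarySpansH2 bW → False := by
  sorry

/-! ### Consistency: each named statement IS its registered stub (definitionally) -/

theorem donaldsonGirouxDecomposition_holds : DonaldsonGirouxDecomposition :=
  stub_donaldsonGirouxDecomposition
theorem complementBetti_holds : ComplementBetti := stub_complementBetti
theorem cappingAdjunction_holds : CappingAdjunction := stub_cappingAdjunction
theorem steinExclusion_holds : SteinExclusion := stub_steinExclusion

/-! ### Name-keyed aliases of the four statements (the hypotheses of the composition) -/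
namespace Registered

/-- Alias of `DonaldsonGirouxDecomposition` keyed by the registered stub name. -/
abbrev stub_donaldsonGirouxDecomposition : Prop := DonaldsonGirouxDecomposition
/-- Alias of `ComplementBetti` keyed by the registered stub name. -/
abbrev stub_complementBetti : Prop := ComplementBetti
/-- Alias of `CappingAdjunction` keyed by the registered stub name. -/
abbrev stub_cappingAdjunction : Prop := CappingAdjunction
/-- Alias of `SteinExclusion` keyed by the registered stub name. -/
abbrev stub_steinExclusion : Prop := SteinExclusion

end Registered

/-! ### Unfolded interface for the stub workers

Theorems files cannot import this Cruxes file, so a landed stub states its signature with the local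
predicates `IsBoothbyWangBoundary` / `IsBoothbyWang` / `flowVector` / `BoundarySpansH2` /
`IsRationalSurfaceCap` UNFOLDED.  The `Unfolded.*` Props below are STUB 2 and STUB 4 verbatim with
the vocabulary unfolded (STUBS 1 and 3 unfold the same way), and the `*_of_unfolded` lemmas
(definitional) are how the registered `stub_*` above get closed by `exact`. -/
namespace Unfolded

/-- `ComplementBetti` (STUB 2), predicates unfolded. -/
def ComplementBetti : Prop :=
  ∀ (P : Type) [TopologicalSpace P] [T2Space P] [SecondCountableTopology P] [CompactSpace P]
    [ChartedSpace (EuclideanSpace ℝ (Fin 4)) P] [IsManifold (𝓡 4) ∞ P]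
    (W : Type) [TopologicalSpace W] [T2Space W] [SecondCountableTopology W] [CompactSpace W]
    [ChartedSpace (EuclideanHalfSpace 4) W] [IsManifold (𝓡∂ 4) ∞ W]
    (D : Type) [TopologicalSpace D] [T2Space D] [SecondCountableTopology D] [CompactSpace D]
    [ChartedSpace (EuclideanHalfSpace 4) D] [IsManifold (𝓡∂ 4) ∞ D]
    (bW : BoundaryData (𝓡∂ 4) W (𝓡 3)) (bD : BoundaryData (𝓡∂ 4) D (𝓡 3))
    (φ : bW.carrier ≃ bD.carrier),
    IsBoundaryGluing bW bD φ (𝓡 4) P →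
    (ConnectedSpace bD.carrier ∧
      Function.Bijective
        (singularHomology.map ℚ ℚ (⟨bD.incl, bD.continuous_incl⟩ : C(bD.carrier, D)) 1) ∧
      (∀ x, singularHomology.map ℚ ℚ (⟨bD.incl, bD.continuous_incl⟩ : C(bD.carrier, D)) 2 x = 0) ∧
      bettiNumber ℚ D 2 = 1) →
    Module.finrank ℤ (singularHomologyZ P 1) = 2 → Module.finrank ℤ (singularHomologyZ P 2) = 1 →
    bettiNumber ℚ W 1 = 2 ∧
      Function.Surjective
        (singularHomology.map ℚ ℚ (⟨bW.incl, bW.continuous_incl⟩ : C(bW.carrier, W)) 2)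

/-- `SteinExclusion` (STUB 4), predicates unfolded. -/
def SteinExclusion : Prop :=
  ∀ (W : Type) [TopologicalSpace W] [T2Space W] [SecondCountableTopology W] [CompactSpace W]
    [ConnectedSpace W] [ChartedSpace (EuclideanHalfSpace 4) W] [IsManifold (𝓡∂ 4) ∞ W]
    (S : SteinStructure W) (bW : BoundaryData (𝓡∂ 4) W (𝓡 3)) (g a : ℕ),
    1 ≤ a → 2 * g = a ^ 2 + a + 2 →
    (∃ (α : MForm (𝓡 3) bW.carrier ℝ 1) (Φ : ℝ → bW.carrier → bW.carrier) (B : Type)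
        (_ : TopologicalSpace B) (_ : T2Space B) (_ : CompactSpace B) (_ : ConnectedSpace B)
        (_ : ChartedSpace (EuclideanSpace ℝ (Fin 2)) B) (_ : IsManifold (𝓡 2) ∞ B)
        (π : bW.carrier → B),
        IsSmoothForm α ∧
        (∀ (y : bW.carrier) (v : EuclideanSpace ℝ (Fin 3)),
          α y ![v] = 0 ↔ v ∈ boundaryPlaneField S.J bW y) ∧
        (∀ y : bW.carrier, ∃ u v w : EuclideanSpace ℝ (Fin 3),
          wedge₁₂ (α y) (mextDeriv α y) u v w ≠ 0) ∧
        ContMDiff (𝓘(ℝ, ℝ).prod (𝓡 3)) (𝓡 3) ∞ (Function.uncurry Φ) ∧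
        Φ 0 = id ∧ (∀ s t : ℝ, Φ (s + t) = Φ s ∘ Φ t) ∧ Φ 1 = id ∧
        (∀ (t : ℝ) (y : bW.carrier), Φ t y = y → ∃ k : ℤ, t = (k : ℝ)) ∧
        (∀ y : bW.carrier,
          α y ![mfderiv 𝓘(ℝ, ℝ) (𝓡 3) (fun t : ℝ => Φ t y) (0 : ℝ) (1 : ℝ)] = 1) ∧
        (∀ (y : bW.carrier) (v : EuclideanSpace ℝ (Fin 3)),
          mextDeriv α y ![mfderiv 𝓘(ℝ, ℝ) (𝓡 3) (fun t : ℝ => Φ t y) (0 : ℝ) (1 : ℝ), v] = 0) ∧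
        Continuous π ∧ Function.Surjective π ∧
        (∀ y y' : bW.carrier, π y = π y' ↔ ∃ t : ℝ, Φ t y = y') ∧
        Module.finrank ℤ (singularHomologyZ B 1) = 2 * g ∧
        Nat.card (Submodule.torsion ℤ (singularHomologyZ bW.carrier 1)) = a ^ 2) →
    bettiNumber ℚ W 1 = 2 →
    Function.Surjective
      (singularHomology.map ℚ ℚ (⟨bW.incl, bW.continuous_incl⟩ : C(bW.carrier, W)) 2) →
    False

end Unfolded

/-- Definitional: the unfolded STUB 2 statement is STUB 2. -/
theorem complementBetti_of_unfolded (h : Unfolded.ComplementBetti) : ComplementBetti :=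
  fun P _ _ _ _ _ _ W _ _ _ _ _ _ D _ _ _ _ _ _ bW bD φ hg hc h1 h2 =>
    h P W D bW bD φ hg hc h1 h2

/-- Definitional: the unfolded STUB 4 statement is STUB 4. -/
theorem steinExclusion_of_unfolded (h : Unfolded.SteinExclusion) : SteinExclusion :=
  fun W _ _ _ _ _ _ _ S bW g a ha hg hBW hb1 hQ => h W S bW g a ha hg hBW hb1 hQ

/-! ### Zero slack (documentation, not a stub): the converse of the reduction -/

/-- **CAPPING CONVERSE** (a THEOREM in print, NOT a stub and not used by the composition; recorded
so that the standing disprover and the lead see that STUB 4 has ZERO SLACK): a compact connected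
Stein domain with Boothby–Wang boundary, `b₁(W; ℚ) = 2` and `Q_W ⊗ ℚ ≡ 0` caps (Giroux
arXiv:1803.05929 Rem 7: collapse the Reeb circles of the boundary of the Liouville domain
`(W, -d^ℂφ)` after a collar adjustment of the contact form) to a closed connected symplectic
4-manifold `X` with `b₁(X) = b₁(W) = 2` and `b₂(X) = b₂(W) − rk(H₂(∂W) → H₂(W)) + 1 = 1` — a
door.  Hence `SteinExclusion ⟸ NoGenusTwoDoor` (and, with STUBS 1–3, `⟹`): the line transfers
the crux LOSSLESSLY from symplectic geography to the Stein/Legendrian filling problem of one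
explicit family of Seifert contact 3-manifolds. -/
def CappingConverse : Prop :=
  ∀ (W : Type) [TopologicalSpace W] [T2Space W] [SecondCountableTopology W] [CompactSpace W]
    [ConnectedSpace W] [ChartedSpace (EuclideanHalfSpace 4) W] [IsManifold (𝓡∂ 4) ∞ W]
    (S : SteinStructure W) (bW : BoundaryData (𝓡∂ 4) W (𝓡 3)) (g n : ℕ),
    IsBoothbyWangBoundary S bW g n → bettiNumber ℚ W 1 = 2 → BoundarySpansH2 bW →
    ¬ NoGenusTwoDoor

/-! ### The composition: the four stubs imply the crux, by name -/

/-- `NoGenusTwoDoor` from the four stubs, by name (pure logic, no `sorry`): a door `(N, s)` with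
`(rank H₁, rank H₂) = (2, 1)` decomposes (STUB 1) as `W ∪_φ D` with `W` Stein, Boothby–Wang
boundary `(g, n)`, `D` a rational-surface cap; Mayer–Vietoris (STUB 2) gives `b₁(W; ℚ) = 2` and
`H₂(∂W; ℚ) ↠ H₂(W; ℚ)`; capping + adjunction (STUB 3) pins `(g, n) = ((a² + a + 2)/2, a²)`,
`a ≥ 1`; Stein exclusion (STUB 4) is the contradiction. -/
theorem NoGenusTwoDoor_of (h1 : Registered.stub_donaldsonGirouxDecomposition)
    (h2 : Registered.stub_complementBetti) (h3 : Registered.stub_cappingAdjunction)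
    (h4 : Registered.stub_steinExclusion) : NoGenusTwoDoor := by
  intro N _ _ _ _ _ _ _ s hs hc hnd hb
  obtain ⟨hb1, hb2⟩ := hb
  obtain ⟨W, _, _, _, _, _, _, _, S, D, _, _, _, _, _, _, bW, bD, φ, g, n, hglue, hcap, hBW⟩ :=
    h1 N s hs hc hnd hb2
  obtain ⟨hW1, hQ⟩ := h2 N W D bW bD φ hglue hcap hb1 hb2
  obtain ⟨a, ha, hn, hg⟩ := h3 W S bW g n hBW hW1 hQ
  subst hn
  exact h4 W S bW g a ha hg hBW hW1 hQ

/-- Wiring check: the registered stubs feed `NoGenusTwoDoor_of` as stated. -/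
example : NoGenusTwoDoor :=
  NoGenusTwoDoor_of stub_donaldsonGirouxDecomposition stub_complementBetti stub_cappingAdjunction
    stub_steinExclusion

/-- Bookkeeping against the landed negative lemma (Disproof §5, `Negative.NoncompactDoor`):
compactness is load-bearing for the crux, and every stub above keeps `[CompactSpace]` on `N`, `W`
and `D`; the refuting witness is the NON-compact `(ℝ² ∖ 0)² ⊂ ℝ⁴`, an instance of no stub. -/
example : ¬ (∀ (N : Type) [TopologicalSpace N] [T2Space N] [SecondCountableTopology N]
    [ConnectedSpace N] [ChartedSpace (EuclideanSpace ℝ (Fin 4)) N] [IsManifold (𝓡 4) ∞ N]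
    (s : MForm (𝓡 4) N ℝ 2), IsSmoothForm s → IsClosedForm s →
      (∀ x (v : TangentSpace (𝓡 4) x), v ≠ 0 → ∃ w, s x ![v, w] ≠ 0) →
      ¬ (Module.finrank ℤ (singularHomologyZ N 1) = 2 ∧
          Module.finrank ℤ (singularHomologyZ N 2) = 1)) :=
  Summit.SmoothPoincare4.SmoothPoincare4.Theorems.NoGenusTwoDoor.Negative.noGenusTwoDoor_false_without_compact

end Summit.SmoothPoincare4.SmoothPoincare4.Cruxes.NoGenusTwoDoor.WeinsteinDoorPresentation

end
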